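import Summits.RiemannHypothesis.RiemannHypothesis.Theorems.GroundBartaPolarPerronFrobeniusEvenSectorBridge
import Summits.RiemannHypothesis.RiemannHypothesis.Theses.EvenSectorBarta
import HarnessLib

/-!
# GroundBarta ⟷ EvenSectorBarta: the two open cruxes are one statement (modulo even-winning)

The draft route `EvenSectorBarta` is reduced (items 19954–19957 closed from the GroundBarta toolkit) to
its single crux `EvenOneSignedWindows` (stmt-RiemannHypothesis-19953): cofinally in the height `a` there
is an EVEN-SECTOR bottom state that is real and `≥ 0` a.e. on `(-a, a)`.  Route `GroundBarta` is reduced to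
`PolarPerronFrobenius` (stmt-RiemannHypothesis-18390: cofinally, even-winning ⇒ a one-signed bottom state of
the FULL windowed form) and `EvenWinsBeyondArch` (stmt-RiemannHypothesis-18807).

This file records the exact logical relation, for the planners' merge:

* `evenOneSignedWindows_iff_cofinal` — item 19953 is, definitionally, cofinal one-signedness in the even
  sector (`IsWeilEvenGroundState`);
* `polarPerronFrobenius_of_evenOneSignedWindows` — **19953 ⇒ 18390** outright (no parity input);
* `evenOneSignedWindows_of_polarPerronFrobenius` — **18390 ∧ 18807 ⇒ 19953** (even-winning beyond
  `log 2 / 2` discharges the premise of `PolarPerronFrobenius`; the one-signed full bottom state is projected to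
  the even sector by `exists_evenSectorOneSigned_of_oneSigned`);
* `riemannHypothesis_of_evenOneSignedWindows` — 19953 ⇒ RH directly (parity-free deciding theorem
  `riemannHypothesis_of_cofinal_evenSectorOneSigned`), so GroundBarta's rung 4 (`EvenWinsBeyondArch`) is only
  needed to pass from full-form to even-sector bottom states, never for the contradiction itself.
-/

set_option linter.dupNamespace false

noncomputable section

open MeasureTheory Set Filter
open Literature.NumberTheory.LFunctions
open Summit.RiemannHypothesis.RiemannHypothesis.Theses.GroundBarta

namespace Summit.RiemannHypothesis.RiemannHypothesis.Theorems.PolarPerronFrobenius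

/-- **Item 19953 in tree vocabulary**: `EvenSectorBarta.EvenOneSignedWindows` is (definitionally) the
statement that beyond every height there is a window `a` carrying an even-sector bottom state
(`IsWeilEvenGroundState a u`) that is real and `≥ 0` a.e. on `(-a, a)`. [folklore] -/
theorem evenOneSignedWindows_iff_cofinal :
    Summit.RiemannHypothesis.RiemannHypothesis.Theses.EvenSectorBarta.EvenOneSignedWindows ↔
      ∀ A : ℝ, ∃ a : ℝ, A ≤ a ∧ ∃ u : ℝ → ℂ, IsWeilEvenGroundState a u ∧
        ∀ᵐ t : ℝ, t ∈ Ioo (-a) a → (u t).im = 0 ∧ 0 ≤ (u t).re := by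
  constructor
  · intro h A
    obtain ⟨a, ha, u, hu, hsign⟩ := h A
    exact ⟨a, ha, u, hu, hsign⟩
  · intro h A
    obtain ⟨a, ha, u, hu, hsign⟩ := h A
    exact ⟨a, ha, u, hu, hsign⟩

/-- **19953 ⇒ 18390**: cofinal one-signed even-sector bottom states give `PolarPerronFrobenius` outright
(the even-winning premise of the latter is simply dropped). [folklore] -/
theorem polarPerronFrobenius_of_evenOneSignedWindows
    (h : Summit.RiemannHypothesis.RiemannHypothesis.Theses.EvenSectorBarta.EvenOneSignedWindows) :
    PolarPerronFrobenius :=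
  polarPerronFrobenius_of_cofinal_evenSectorOneSigned (evenOneSignedWindows_iff_cofinal.1 h)

/-- **19953 ⇒ RH** directly, by the parity-free deciding theorem
`riemannHypothesis_of_cofinal_evenSectorOneSigned` (even-sector Barta floor against even-sector
off-line negativity). [folklore] -/
theorem riemannHypothesis_of_evenOneSignedWindows
    (h : Summit.RiemannHypothesis.RiemannHypothesis.Theses.EvenSectorBarta.EvenOneSignedWindows) :
    RiemannHypothesis :=
  riemannHypothesis_of_cofinal_evenSectorOneSigned (evenOneSignedWindows_iff_cofinal.1 h)

/-- **18390 ∧ 18807 ⇒ 19953**: `PolarPerronFrobenius` together with even-winning beyond the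
archimedean range (`EvenWinsBeyondArch`, GroundBarta rung 4) gives cofinal one-signed EVEN-SECTOR bottom
states.  At a good height `a ≥ 1 > log 2 / 2` the rung-4 hypothesis is exactly the premise of
`PolarPerronFrobenius`; the resulting one-signed bottom state of the full form has a one-signed even part,
which is an even-sector bottom state (`exists_evenSectorOneSigned_of_oneSigned`). [folklore] -/
theorem evenOneSignedWindows_of_polarPerronFrobenius (hPF : PolarPerronFrobenius)
    (hEven : EvenWinsBeyondArch) :
    Summit.RiemannHypothesis.RiemannHypothesis.Theses.EvenSectorBarta.EvenOneSignedWindows := by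
  refine evenOneSignedWindows_iff_cofinal.2 fun A => ?_
  obtain ⟨a, hA, hmat⟩ := polarPerronFrobenius_iff_groundEnergy.1 hPF (max A 1)
  have ha1 : (1 : ℝ) ≤ a := (le_max_right A 1).trans hA
  have ha : 0 < a := lt_of_lt_of_le one_pos ha1
  have hlog : Real.log 2 / 2 < a := by
    have h2 : Real.log 2 < 0.6931471808 := Real.log_two_lt_d9
    linarith
  have hle : weilEvenGroundEnergy a ≤ weilOddGroundEnergy a :=
    weilEvenGroundEnergy_le_weilOddGroundEnergy_of_evenWinsAt ha (hEven a hlog)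
  obtain ⟨u, hu, hsign⟩ := hmat hle
  exact ⟨a, (le_max_left A 1).trans hA, exists_evenSectorOneSigned_of_oneSigned hu hsign⟩

/-- **Summary of the merge**: given GroundBarta's rung 4 (`EvenWinsBeyondArch`), the two open cruxes
`GroundBarta.PolarPerronFrobenius` (18390) and `EvenSectorBarta.EvenOneSignedWindows` (19953) are
equivalent. [folklore] -/
theorem polarPerronFrobenius_iff_evenOneSignedWindows (hEven : EvenWinsBeyondArch) :
    PolarPerronFrobenius ↔
      Summit.RiemannHypothesis.RiemannHypothesis.Theses.EvenSectorBarta.EvenOneSignedWindows :=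
  ⟨fun h => evenOneSignedWindows_of_polarPerronFrobenius h hEven,
    polarPerronFrobenius_of_evenOneSignedWindows⟩

end Summit.RiemannHypothesis.RiemannHypothesis.Theorems.PolarPerronFrobenius

end
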